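import Summits.BirchSwinnertonDyer.BirchSwinnertonDyer.Theorems.ClassRecordThreeCornerTwistWitnessKernel
import HarnessLib

/-!
# Route `ClassRecordThree` (rung K2@3): the `closes` kernel WITHOUT the Schneider binder, in the
# route's rev-34 currency (H3 oriented `IMCDivAt₃B`, consumed pure-β upper half, twist-witness corner)
# — D-0145 ideator seat bsd-idea-4 gen 7, `--supports stmt-BirchSwinnertonDyer-19106 --as helper`

HELPER. BSD is not proved; the leaf stays CONDITIONAL on every binder. Companion of
`Theorems/ClassRecordThreeSchneiderFreeKernel.lean` (p630907, v4.5′ currency). What IS proved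
(sorry-free): `SchneiderFreeSwap.multiplicativeRankOneAtThree_of_bdpRoadOnRam_upperB_of_twistWitness`
— `Theorems.multiplicativeRankOneAtThree_of_classRecord_upperB_of_twistWitness` (the kernel the
route's `closes` runs through) with road (a) — `hReg` (= crux 19106 `SchneiderAtThree`) and its five
published facts `hSkA hJn hHn hD hpar` — DELETED, and `hDb`/`hHb`/`hUβ`/`hUγ` stated on ALL of (ram)
(the hypothesis `W.HasSplitMultiplicativeReductionAtPrime 3` dropped). Per pair: `Surj` ⇒ STEP L from
the descent residual + H2 ∧ H3ᴮ (`stepLAt_of_halves₃_of_classX11bB`, λ-supply = `lambdaSupplyAt₃`) and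
`Three.bsdp_three_of_surj_of_stepLAt_of_shapes_upper`; `¬Surj` ⇒ the twist-witness corner verbatim.
USE (memo `pub/ideators/bsd-idea-4/lines/g7/SWAP-19106-memo.md` §6, sketch `CR3SwapGlue.lean`, farm-checked):
the route's `closes` with `h₁ : SchneiderAtThree` deleted elaborates through this kernel after widening
exactly two items (20262 `IMCDivTwoLociAtThreeR`, 19109 `EulerHalvesAtThree`: split(3) dropped), every
other binder verbatim — in rev 34 the descent and H2 are already supplied locus-free from BDP13 Thm 5.4,
Tate–Sen and LZZ, and the Shimura pure-β supplier never reads the split hypothesis. Nothing booked; no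
route opened or edited here (that is the pen's `route edit --closes-file`).
[cite: Castella2018, Thm. A (arXiv:1704.06608 p. 3) (road (b) uniform in a_p = ±1; hypothesis at p ∣ N = (ram))]
[cite: Hsieh2014, Thm. 1 (arXiv:1112.1580 pp. 3–4)] [cite: MatarNekovar2019, Thm. 0.3 (p. 456)]
-/

noncomputable section

open scoped Classical

open WeierstrassCurve NumberField IsDedekindDomain Field Literature.NumberTheory.EllipticCurves
  Rat.HeightOneSpectrum
  Literature.NumberTheory.DiophantineGeometry
  Literature.NumberTheory.EllipticCurves.GreenbergSelmer
  Literature.NumberTheory.EllipticCurves.ModularForms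
  Literature.NumberTheory.EllipticCurves.Rank1Residual
  Literature.NumberTheory.EllipticCurves.Rank1Residual.Typed
  Literature.NumberTheory.EllipticCurves.Wuthrich2014
  Literature.NumberTheory.EllipticCurves.BalakrishnanEtAl2019
  Literature.NumberTheory.EllipticCurves.Skinner2016
  Literature.NumberTheory.EllipticCurves.SteinWuthrich2013
  Literature.NumberTheory.EllipticCurves.Disegni2020
  Literature.NumberTheory.EllipticCurves.BarriosEtAl2025
  Literature.NumberTheory.QuadraticFields.Quadratic
  Literature.NumberTheory.Automorphic
  Literature.NumberTheory.GaloisRepresentations Literature.NumberTheory.GaloisCohomology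
  Summit.BirchSwinnertonDyer.Rank1Residual.X11b.AcSelmer
  Summit.BirchSwinnertonDyer.Rank1Residual.X11b.LocBridge
  Summit.BirchSwinnertonDyer.Rank1Residual
  Summit.BirchSwinnertonDyer.Rank1Residual.X11b
  Summit.BirchSwinnertonDyer.Rank1Residual.X11b.Three

set_option linter.dupNamespace false

namespace Summit.BirchSwinnertonDyer.BirchSwinnertonDyer.Theorems.SchneiderFreeSwap

/-- **K2@3 `closes` kernel, Schneider-FREE twin** of
`multiplicativeRankOneAtThree_of_classRecord_upperB_of_twistWitness`: road (a) (`hReg` + its five facts)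
deleted; `hDb`/`hHb`/`hUβ`/`hUγ` on all of (ram) (split hypothesis dropped). -/
theorem multiplicativeRankOneAtThree_of_bdpRoadOnRam_upperB_of_twistWitness
    (hGZ : ∀ (N : ℕ) [NeZero N] (W : WeierstrassCurve ℚ) (K : Type) [Field K] [NumberField K],
      gross_zagier N W K)
    (hKo : ∀ (N : ℕ) [NeZero N] (W : WeierstrassCurve ℚ) (K : Type) [Field K] [NumberField K],
      kolyvagin N W K)
    (hB : ∀ (N : ℕ) [NeZero N] (W : WeierstrassCurve ℚ) (K : Type) [Field K] [NumberField K],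
      Kolyvagin1990_padicValNat_card_sha_le N W K)
    (hSk : Skinner2016.thmC_padicValRat_bsd_rank_zero) (hWu : sha_dvd_analyticSha)
    (hGZK : rank_eq_analyticRank_of_analyticRank_le_one) (hmod : hasEntireLFunction_rat)
    (hnf : exists_isNewformOf) (hHL : HoffsteinLuo1997_exists_twist_L_one_ne_zero)
    (hMaz : mazur_not_dvd_maninConstant_of_odd)
    (hPT : ∀ (K : Type) [Field K] [NumberField K], poitouTate_sum_localTatePairing_eq_zero K)
    (hMN : ∀ (N : ℕ) [NeZero N] (W : WeierstrassCurve ℚ) (K : Type) [Field K] [NumberField K],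
      MatarNekovar2019.thm03_padicValNat_card_sha_le_of_irreducible N W K)
    (hH : hsieh2014_exists_anticyclotomicPAdicLFunction)
    (hDr : ∀ (W : WeierstrassCurve ℚ) [W.IsElliptic] [W.IsGloballyMinimal],
      ClassX11b W 3 → Ram W 3 → HsiehDescentAt₃ W)
    (hDd : ∀ (W : WeierstrassCurve ℚ) [W.IsElliptic] [W.IsGloballyMinimal],
      ClassX11b W 3 → ¬ Ram W 3 → Surj W 3 → HsiehDescentAt₃ W)
    (hHr : ∀ (W : WeierstrassCurve ℚ) [W.IsElliptic] [W.IsGloballyMinimal],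
      ClassX11b W 3 → Ram W 3 → BDPValueAt₃ W ∧ IMCDivAt₃B W)
    (hHd : ∀ (W : WeierstrassCurve ℚ) [W.IsElliptic] [W.IsGloballyMinimal],
      ClassX11b W 3 → ¬ Ram W 3 → Surj W 3 → BDPValueAt₃ W ∧ IMCDivAt₃B W)
    (hUβ : ∀ (W : WeierstrassCurve ℚ) [W.IsElliptic] [W.IsGloballyMinimal],
      ClassX11b W 3 → Ram W 3 → ¬ ShapeAlpha W → ¬ ShapeGamma W → 3 ∣ W.tamagawaProduct →
        Typed.MissingUpperBoundAt W 3)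
    (hUα : ∀ (W : WeierstrassCurve ℚ) [W.IsElliptic] [W.IsGloballyMinimal],
      ClassX11b W 3 → Ram W 3 → ShapeAlpha W → Typed.MissingUpperBoundAt W 3)
    (hUγ : ∀ (W : WeierstrassCurve ℚ) [W.IsElliptic] [W.IsGloballyMinimal],
      ClassX11b W 3 → Ram W 3 → ¬ ShapeAlpha W → ShapeGamma W → Typed.MissingUpperBoundAt W 3)
    (hU₀ : ∀ (W : WeierstrassCurve ℚ) [W.IsElliptic] [W.IsGloballyMinimal],
      ClassX11b W 3 → Surj W 3 → ¬ Ram W 3 → Typed.MissingUpperBoundAt W 3)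
    (hCL : ∀ (W : WeierstrassCurve ℚ) [W.IsElliptic] [W.IsGloballyMinimal], CornerStepLAt W)
    (hCW : ∀ (W : WeierstrassCurve ℚ) [W.IsElliptic] [W.IsGloballyMinimal],
      CornerTwistWitness.CornerTwistWitnessAt W)
    (hCU : ∀ (W : WeierstrassCurve ℚ) [W.IsElliptic] [W.IsGloballyMinimal], CornerUpperAt W) :
    MultiplicativeRankOneAtThree := by
  intro W _ _ hX
  have hEP : ∀ (K : Type) [Field K] [NumberField K] (v : HeightOneSpectrum (𝓞 K)),
      localEulerPoincareCharacteristic (v.adicCompletion K) :=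
    GaloisImage.EP.localEulerPoincareCharacteristic_adicCompletion
  by_cases hsurj : Surj W 3
  · -- roads (b′) ∪ (d) = all of `Surj`: StepLAt W from the descent residual + H2 ∧ H3
    have hL : StepLAt W := by
      by_cases hram : Ram W 3
      · exact stepLAt_of_halves₃_of_classX11bB hnf hKo hPT hEP hX
          (bdpExistsAt₃_of_hsieh2014_of_descent W hH lambdaSupplyAt₃ (hDr W hX hram))
          (hHr W hX hram).1 (hHr W hX hram).2
      · exact stepLAt_of_halves₃_of_classX11bB hnf hKo hPT hEP hX
          (bdpExistsAt₃_of_hsieh2014_of_descent W hH lambdaSupplyAt₃ (hDd W hX hram hsurj))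
          (hHd W hX hram hsurj).1 (hHd W hX hram hsurj).2
    exact Three.bsdp_three_of_surj_of_stepLAt_of_shapes_upper hGZ hKo hB hSk hWu hGZK hmod hnf hHL hMaz
      hPT hEP W hX hsurj hL (fun hram hα hγ ht ↦ hUβ W hX hram hα hγ ht)
      (fun hram hα ↦ hUα W hX hram hα) (fun hram hα hγ ↦ hUγ W hX hram hα hγ)
      (fun h ↦ hU₀ W hX hsurj h)
  · -- the corner, verbatim
    refine Typed.bsdp_of_missingPPartAt W 3 hGZK (by rw [hX.1]) ?_
    exact CornerTwistWitness.missingPPartAt_of_corner_of_witness hGZ hKo hGZK hmod hnf hMaz hPT hEP hMN W hX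
      hsurj (hCL W) (hCW W) (fun ht ↦
        CornerTwistWitness.missingUpperBoundAt_of_cornerUpperAt_of_cornerTwistWitnessAt hGZ hKo hGZK hmod hnf
          hMaz W hX hsurj ht (hCU W) (hCW W))

end Summit.BirchSwinnertonDyer.BirchSwinnertonDyer.Theorems.SchneiderFreeSwap

end
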